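import Literature.Geometry.Kaehler.ComplexTorusMumfordTateGroupHodgeCircleSigmaPiNonCMFactor
import HarnessLib

/-!
# The Hodge-circle locus read on complex points: `Hg(X)(ℝ) = h(S¹)` ⟺ `Hg(X)(ℂ) = ν(ℂ^×)` ⟺ `Hg(X)(ℂ) ⊆ ν(ℂ^×)`
# ⟺ `MT(X)(ℂ) = h_ℂ(ℂ^× × ℂ^×)` ⟺ `MT(X)(ℂ) ⊆ h_ℂ(ℂ^× × ℂ^×)` — the converse of g35-#3, any dimension
# (Imai 1976 §2 «`Hg(E)` is a 1-dimensional torus if and only if `E` is of CM-type»; Moonen–Zarhin 1999 (2.2); Lange 2023 §7.2.1)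

Layer `Literature/Geometry/Kaehler`, namespace `Literature.Geometry.Kaehler.ComplexTorus`; lane `lit-hodgefound`
(Track 2 foundations library), Layer A3/A4 (Hodge groups and Mumford–Tate groups; CM abelian varieties); prover seat
`lit-hodgefound-p17` (generation 35, self-proposed row g35-#7 = pointer (η): the converse of g35-#3). Sequel, BY NAME and
without restating anything, of g35-#3 `ComplexTorusHodgeGroupHodgeCircleComplexPoints`
(`hodgeGroupC_eq_range_complexCircleHom_of_coe_hodgeGroup_eq_range`, `mumfordTateGroupC_eq_range_hodgeSCGL_of_coe_hodgeGroup_eq_range`),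
of g35-#6 `ComplexTorusMumfordTateGroupHodgeCircleSigmaPiNonCMFactor` (`hodgeSC_eq_map_ofRealHom_iff`: a REAL value of `h_ℂ`
is `h_ℂ(z, z̄) = h(z) ⊗ 1`), of p22's `ComplexTorusHodgeGroupCompactRealForm` / `ComplexTorusMumfordTateGroup`
(`map_ofRealHom_mem_hodgeGroupC_iff`: `Hg(ℝ) = Hg(ℂ) ∩ SL(V_ℝ)`; `coe_map_ofRealHom`, `toGL_mem_mumfordTateGroupC`, `hodgeS_exp_mul_I`,
`det_hodgeS`) and of `ComplexTorusHodgeGroupHodgeCircle` (`coe_hodgeGroup_eq_range_hodgeCircleSL_iff`). The tree's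
`hodgeGroupC_ellipticPeriod_eq_range_complexCircleHom_iff` / `mumfordTateGroupC_ellipticPeriod_eq_range_hodgeSCGL_iff` are the
elliptic-curve cases (via `End(E_τ) ≠ ℤ`). THEOREMS ONLY (no definition, no instance, no named fact; D-0026 net debt 0).

## The argument

If `Hg(X)(ℂ) ⊆ ν(ℂ^×)`, a real point `M ∈ Hg(X)(ℝ) ⊆ Hg(X)(ℂ)` is `ν(u) = h_ℂ(u, u⁻¹)` with REAL entries, so `u⁻¹ = ū`
(g35-#6), `|u| = 1`, `u = e^{iθ}` and `M = h(e^{iθ})`: `Hg(X)(ℝ) = h(S¹)`. If only `MT(X)(ℂ) ⊆ h_ℂ(ℂ^× × ℂ^×)`, then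
`M ⊗ 1 = h_ℂ(z, w)` real gives `w = z̄`, `M = h(z)` with `1 = det M = |z|^{2g}`, so again `|z| = 1`.

## Sources, verbatim

* H. Imai, *On the Hodge groups of some abelian varieties*, Kōdai Math. Sem. Rep. 27 (1976), §2 (p. 368 L5–L7): "`Hg(E)` is a
  1-dimensional torus if `E` is of CM-type, and `Hg(E) = SL(V)` otherwise".
* B. Moonen, Yu. G. Zarhin, Math. Ann. 315 (1999), §2 (2.2) (held `paper:arxiv-math_9901113`, p0005 L26–L49): "Type IV(1,1): …
  `Hg(X) = U_F`"; §1 (p0002): "`Hg(X)` is a torus if and only if `X` is of CM-type".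
* H. Lange, *Abelian Varieties over the Complex Numbers* (2023), §7.2.1 (p. 329: "`Hg(X)` is the smallest `ℚ`-algebraic subgroup
  … with `h(S¹) ⊆ Hg(X)(ℝ)`"), Remark 7.1.2 ("`det h(e^{iθ}) = 1`"), Remark 7.2.2 (1), (2).
* B. Moonen, *An introduction to Mumford–Tate groups* (2004), (3.2) ("on the real points `S(ℝ) = ℂ^*` … `(z, z̄)`").

## What is proved (`ν = complexCircleHom Φ`, `h_ℂ = hodgeSC Φ`, `[Nonempty ι]`)

* §1 `complexCircle_eq_map_ofRealHom_iff` (`ν(u)` real ⟺ `|u| = 1 ∧` the real matrix is `h(u)`).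
* §2 **`coe_hodgeGroup_eq_range_of_hodgeGroupC_le_range`** (`Hg(X)(ℂ) ⊆ ν(ℂ^×) ⟹ Hg(X)(ℝ) = h(S¹)`),
  **`hodgeGroupC_eq_range_complexCircleHom_iff`** (`Hg(X)(ℂ) = ν(ℂ^×) ⟺ Hg(X)(ℝ) = h(S¹)`),
  `hodgeGroupC_le_range_complexCircleHom_iff`.
* §3 **`coe_hodgeGroup_eq_range_of_mumfordTateGroupC_le_range`** (`MT(X)(ℂ) ⊆ h_ℂ(ℂ^× × ℂ^×) ⟹ Hg(X)(ℝ) = h(S¹)`),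
  **`mumfordTateGroupC_eq_range_hodgeSCGL_iff`**, `mumfordTateGroupC_le_range_hodgeSCGL_iff`.

## References

* [Imai1976HodgeGroups] H. Imai, Kōdai Math. Sem. Rep. 27 (1976), §2 (p. 368).
* [MoonenZarhin1999LowDim] B. Moonen, Yu. Zarhin, Math. Ann. 315 (1999), §1, §2 (2.2).
* [Lange2023AbelianVarietiesComplex] H. Lange (2023), §7.1.1 Remark 7.1.2, §7.2.1 and Remark 7.2.2.
* [Moonen2004MT] B. Moonen (2004), (3.2).
-/

noncomputable section

open scoped Real ComplexConjugate
open Complex Module Matrix Function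

namespace Literature.Geometry.Kaehler

namespace ComplexTorus

variable {ι : Type*} [Fintype ι] [DecidableEq ι] {E : Type*} [NormedAddCommGroup E] [NormedSpace ℂ E]
  (Φ : (ι → ℝ) ≃L[ℝ] E)

/-! ## §1 Real values of the complexified circle -/

omit [Fintype ι] [DecidableEq ι] in
/-- `u⁻¹ = ū` (`u ≠ 0`) forces `|u| = 1` (`u ū = |u|²`). [folklore] -/
private theorem norm_eq_one_of_inv_eq_conj {u : ℂ} (hu : u ≠ 0) (h : u⁻¹ = conj u) : ‖u‖ = 1 := by
  have h1 : (Complex.normSq u : ℂ) = 1 := by rw [← Complex.mul_conj, ← h, mul_inv_cancel₀ hu]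
  have h2 : Complex.normSq u = 1 := by exact_mod_cast h1
  rw [Complex.normSq_eq_norm_sq] at h2
  exact (pow_eq_one_iff_of_nonneg (norm_nonneg u) two_ne_zero).1 h2

/-- **`ν(u)` is a REAL matrix iff `|u| = 1`, and then it is `h(u) ⊗ 1`** (`ν(u) = h_ℂ(u, u⁻¹)` is real iff `u⁻¹ = ū`).
[cite: Moonen2004MT, (3.2) ("on the real points … `(z, z̄)`")] [cite: Lange2023AbelianVarietiesComplex, §7.2.1 Remark 7.2.2 (1)] -/
theorem complexCircle_eq_map_ofRealHom_iff [Nonempty ι] {u : ℂ} (hu : u ≠ 0) {X : Matrix ι ι ℝ} :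
    complexCircle Φ u = X.map Complex.ofRealHom ↔ ‖u‖ = 1 ∧ X = hodgeS Φ u := by
  rw [← hodgeSC_inv, hodgeSC_eq_map_ofRealHom_iff]
  exact and_congr ⟨norm_eq_one_of_inv_eq_conj hu, Complex.inv_eq_conj⟩ Iff.rfl

/-! ## §2 `Hg(X)(ℂ) ⊆ ν(ℂ^×)` forces the locus -/

/-- **`Hg(X)(ℂ) ⊆ ν(ℂ^×) ⟹ Hg(X)(ℝ) = h(S¹)`**: a real point of `ν(ℂ^×)` is `ν(e^{iθ}) = h(e^{iθ}) ⊗ 1`.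
[cite: Imai1976HodgeGroups, §2 (p. 368 L5–L7)] [cite: MoonenZarhin1999LowDim, §2 (2.2)] [cite: Lange2023AbelianVarietiesComplex, §7.2.1 (p. 329)] -/
theorem coe_hodgeGroup_eq_range_of_hodgeGroupC_le_range [Nonempty ι] (hC : hodgeGroupC Φ ≤ (complexCircleHom Φ).range) :
    (hodgeGroup Φ : Set (SpecialLinearGroup ι ℝ)) = Set.range (hodgeCircleSL Φ) := by
  refine (coe_hodgeGroup_eq_range_hodgeCircleSL_iff Φ).2 fun M hM ↦ ?_
  obtain ⟨u, hu⟩ := hC ((map_ofRealHom_mem_hodgeGroupC_iff Φ).2 hM)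
  have hmat : complexCircle Φ u = (M : Matrix ι ι ℝ).map Complex.ofRealHom := by
    rw [← coe_complexCircleHom, hu, coe_map_ofRealHom]
  obtain ⟨hnorm, hX⟩ := (complexCircle_eq_map_ofRealHom_iff Φ u.ne_zero).1 hmat
  obtain ⟨θ, hθ⟩ := (Complex.norm_eq_one_iff (u : ℂ)).1 hnorm
  refine ⟨θ, Subtype.ext ?_⟩
  rw [hX, coe_hodgeCircleSL, ← hodgeS_exp_mul_I, hθ]

/-- **`Hg(X)(ℂ) = ν(ℂ^×) ⟺ Hg(X)(ℝ) = h(S¹)`**: the Hodge-circle locus read on complex points, any dimension (Imai's "`Hg(E)`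
is a 1-dimensional torus iff `E` is of CM-type" beyond curves; `⟸` is g35-#3). [cite: Imai1976HodgeGroups, §2 (p. 368 L5–L7)]
[cite: MoonenZarhin1999LowDim, §1 and §2 (2.2)] [cite: Lange2023AbelianVarietiesComplex, §7.2.1 Remark 7.2.2 (1)] -/
theorem hodgeGroupC_eq_range_complexCircleHom_iff [Nonempty ι] :
    hodgeGroupC Φ = (complexCircleHom Φ).range ↔
      (hodgeGroup Φ : Set (SpecialLinearGroup ι ℝ)) = Set.range (hodgeCircleSL Φ) :=
  ⟨fun h ↦ coe_hodgeGroup_eq_range_of_hodgeGroupC_le_range Φ h.le,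
    hodgeGroupC_eq_range_complexCircleHom_of_coe_hodgeGroup_eq_range Φ⟩

/-- … and `Hg(X)(ℂ) ⊆ ν(ℂ^×)` is already equivalent (the inclusion `⊇` always holds). [cite: Imai1976HodgeGroups, §2 (p. 368 L5–L7)]
[cite: Deligne1982HodgeCycles, I §3 Prop. 3.4 ("`μ(𝔾_m) ⊆ G_ℂ`")] -/
theorem hodgeGroupC_le_range_complexCircleHom_iff [Nonempty ι] :
    hodgeGroupC Φ ≤ (complexCircleHom Φ).range ↔
      (hodgeGroup Φ : Set (SpecialLinearGroup ι ℝ)) = Set.range (hodgeCircleSL Φ) := by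
  refine ⟨coe_hodgeGroup_eq_range_of_hodgeGroupC_le_range Φ, fun h ↦ ?_⟩
  exact (hodgeGroupC_eq_range_complexCircleHom_of_coe_hodgeGroup_eq_range Φ h).le

/-! ## §3 `MT(X)(ℂ) ⊆ h_ℂ(ℂ^× × ℂ^×)` forces the locus -/

/-- **`MT(X)(ℂ) ⊆ h_ℂ(ℂ^× × ℂ^×) ⟹ Hg(X)(ℝ) = h(S¹)`**: a real point `M` of `Hg` has `M ⊗ 1 = h_ℂ(z, w)` real, so `w = z̄`,
`M = h(z)` with `1 = det M = |z|^{2g}`, i.e. `|z| = 1`. [cite: MoonenZarhin1999LowDim, §2 (2.2) ("`MT(X) = T_F`")]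
[cite: Lange2023AbelianVarietiesComplex, §7.1.1 Remark 7.1.2 and §7.2.1 Remark 7.2.2 (2)] [cite: Moonen2004MT, (3.2)] -/
theorem coe_hodgeGroup_eq_range_of_mumfordTateGroupC_le_range [Nonempty ι] (hC : mumfordTateGroupC Φ ≤ (hodgeSCGL Φ).range) :
    (hodgeGroup Φ : Set (SpecialLinearGroup ι ℝ)) = Set.range (hodgeCircleSL Φ) := by
  refine (coe_hodgeGroup_eq_range_hodgeCircleSL_iff Φ).2 fun M hM ↦ ?_
  obtain ⟨⟨z, w⟩, hzw⟩ := hC (toGL_mem_mumfordTateGroupC Φ ((map_ofRealHom_mem_hodgeGroupC_iff Φ).2 hM))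
  have hmat : hodgeSC Φ z w = (M : Matrix ι ι ℝ).map Complex.ofRealHom := by
    have h0 := congrArg Units.val hzw
    rw [coe_hodgeSCGL, Matrix.SpecialLinearGroup.coe_GL_coe_matrix, coe_map_ofRealHom] at h0
    exact h0
  obtain ⟨-, hX⟩ := (hodgeSC_eq_map_ofRealHom_iff Φ).1 hmat
  -- `det M = 1 = |z|^{2g}` forces `|z| = 1`
  have hnorm : ‖(z : ℂ)‖ = 1 := by
    have hdet : ‖(z : ℂ)‖ ^ Fintype.card ι = 1 := by rw [← det_hodgeS Φ, ← hX, M.2]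
    exact (pow_eq_one_iff_of_nonneg (norm_nonneg _) Fintype.card_ne_zero).1 hdet
  obtain ⟨θ, hθ⟩ := (Complex.norm_eq_one_iff (z : ℂ)).1 hnorm
  refine ⟨θ, Subtype.ext ?_⟩
  rw [hX, coe_hodgeCircleSL, ← hodgeS_exp_mul_I, hθ]

/-- **`MT(X)(ℂ) = h_ℂ(ℂ^× × ℂ^×) ⟺ Hg(X)(ℝ) = h(S¹)`** (`⟸` is g35-#3). [cite: MoonenZarhin1999LowDim, §2 (2.2)]
[cite: CarlsonMullerStachPeters2017, §15.2 Examples 15.2.4 (ii)] [cite: Lange2023AbelianVarietiesComplex, §7.2.1 Remark 7.2.2 (2)] -/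
theorem mumfordTateGroupC_eq_range_hodgeSCGL_iff [Nonempty ι] :
    mumfordTateGroupC Φ = (hodgeSCGL Φ).range ↔
      (hodgeGroup Φ : Set (SpecialLinearGroup ι ℝ)) = Set.range (hodgeCircleSL Φ) :=
  ⟨fun h ↦ coe_hodgeGroup_eq_range_of_mumfordTateGroupC_le_range Φ h.le,
    mumfordTateGroupC_eq_range_hodgeSCGL_of_coe_hodgeGroup_eq_range Φ⟩

/-- … and `MT(X)(ℂ) ⊆ h_ℂ(ℂ^× × ℂ^×)` is already equivalent. [cite: MoonenZarhin1999LowDim, §2 (2.2)]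
[cite: Lange2023AbelianVarietiesComplex, §7.2.1 Remark 7.2.2 (2)] -/
theorem mumfordTateGroupC_le_range_hodgeSCGL_iff [Nonempty ι] :
    mumfordTateGroupC Φ ≤ (hodgeSCGL Φ).range ↔
      (hodgeGroup Φ : Set (SpecialLinearGroup ι ℝ)) = Set.range (hodgeCircleSL Φ) := by
  refine ⟨coe_hodgeGroup_eq_range_of_mumfordTateGroupC_le_range Φ, fun h ↦ ?_⟩
  exact (mumfordTateGroupC_eq_range_hodgeSCGL_of_coe_hodgeGroup_eq_range Φ h).le

end ComplexTorus

end Literature.Geometry.Kaehler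

end
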